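import Summits.Ventures.PercRepro.RankLevelSetAvgMid
import Summits.Ventures.PercRepro.RankLevelSetAvgTopS

/-!
# PercRepro — [re-pointed at the primed (`_S`) parents per (um)(35)(2)–(4); the landed originals are the citations]
# THE AVERAGED CONTRACTION IDENTITY on the tight layer
(night-1, gen 9 session 4; paper proofs/NIGHT-1-C025-induction.md §19.12 (a))

For a loopless matroid on the tight layer `|E| = p + q`, summing `σ_M(p,q) − σ_{M ／ {e}}(p − 1, q)` over all `e ∈ E`
gives an identity in which the contraction side has disappeared:
`n·σ_M(p,q) − Σ_e σ_{M／e}(p−1,q) = [n·#Y_M(p,q) − Σ_{T ∈ Y_M(p,q+1)} |T|] − Φ(p,q)·n·#U_M(p,q) + Φ(p−1,q)·Σ_{A∈U} |A ∖ cl(E∖A)|`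
(`avg_slack_identity`), by the two halves `sum_midCount_contract_eq` and `sum_topCount_contract_eq_S`.  Consequently
(MC) averaged — `Σ_e σ_{M／e}(p−1,q) ≤ n·σ_M(p,q)`, which gives C-037's `(MC∃)` — is equivalent to the supply/demand
inequality `n·#Y − Σ_{T∈Y(p,q+1)}|T| + Φ′·Σ_A |A∖cl(E∖A)| ≥ n·Φ·#U` (`avg_contract_le_iff`).

Axioms: standard.
-/
open scoped Matroid

namespace PercRepro

open Set Finset

variable {α : Type} (M : Matroid α) [M.Finite]

/-- **THE AVERAGED CONTRACTION IDENTITY** (tight layer `|E| = p + q`, every element a non-loop, `1 ≤ p`). -/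
theorem avg_slack_identity (hl : ∀ e ∈ M.E, M.IsNonloop e) {p q : ℕ} (hp : 1 ≤ p)
    (hE : M.E.ncard = p + q) :
    (M.E.ncard : ℚ) * Matroid.slack M p q -
        ∑ e ∈ (M.set_finite M.E).toFinset, Matroid.slack (M ／ {e}) (p - 1) q =
      ((M.E.ncard : ℚ) * (Matroid.midCount M p q : ℚ) -
          ∑ T ∈ (Yset_finite M p (q + 1)).toFinset, (T.ncard : ℚ)) -
        phiK p q * (M.E.ncard : ℚ) * (Matroid.topCount M p q : ℚ) +
        phiK (p - 1) q * ∑ A ∈ (Uset_finite_S M p q).toFinset, ((A \ M.closure (M.E \ A)).ncard : ℚ) := by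
  have hmid := sum_midCount_contract_eq M hl (q := q) hp
  have htop := sum_topCount_contract_eq_S M hl hp hE
  have hmid_q : (∑ e ∈ (M.set_finite M.E).toFinset, (Matroid.midCount (M ／ {e}) (p - 1) q : ℚ)) =
      ∑ T ∈ (Yset_finite M p (q + 1)).toFinset, (T.ncard : ℚ) := by exact_mod_cast hmid
  have htop_q : (∑ e ∈ (M.set_finite M.E).toFinset, (Matroid.topCount (M ／ {e}) (p - 1) q : ℚ)) =
      ∑ A ∈ (Uset_finite_S M p q).toFinset, ((A \ M.closure (M.E \ A)).ncard : ℚ) := by exact_mod_cast htop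
  unfold Matroid.slack
  rw [Finset.sum_sub_distrib, ← Finset.mul_sum, hmid_q, htop_q]
  ring

/-- The averaged (MC) on the tight layer, `Σ_e σ_{M／e}(p−1,q) ≤ n·σ_M(p,q)`, is equivalent to the supply/demand
inequality `n·#Y_M(p,q) − Σ_{T ∈ Y_M(p,q+1)} |T| + Φ(p−1,q)·Σ_{A∈U} |A ∖ cl(E∖A)| ≥ n·Φ(p,q)·#U_M(p,q)`. -/
theorem avg_contract_le_iff (hl : ∀ e ∈ M.E, M.IsNonloop e) {p q : ℕ} (hp : 1 ≤ p)
    (hE : M.E.ncard = p + q) :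
    (∑ e ∈ (M.set_finite M.E).toFinset, Matroid.slack (M ／ {e}) (p - 1) q ≤
        (M.E.ncard : ℚ) * Matroid.slack M p q) ↔
      (M.E.ncard : ℚ) * phiK p q * (Matroid.topCount M p q : ℚ) ≤
        ((M.E.ncard : ℚ) * (Matroid.midCount M p q : ℚ) -
            ∑ T ∈ (Yset_finite M p (q + 1)).toFinset, (T.ncard : ℚ)) +
          phiK (p - 1) q * ∑ A ∈ (Uset_finite_S M p q).toFinset, ((A \ M.closure (M.E \ A)).ncard : ℚ) := by
  have h := avg_slack_identity M hl hp hE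
  constructor
  · intro hle
    have : 0 ≤ (M.E.ncard : ℚ) * Matroid.slack M p q -
        ∑ e ∈ (M.set_finite M.E).toFinset, Matroid.slack (M ／ {e}) (p - 1) q := by linarith
    rw [h] at this
    linarith
  · intro hge
    have : 0 ≤ (M.E.ncard : ℚ) * Matroid.slack M p q -
        ∑ e ∈ (M.set_finite M.E).toFinset, Matroid.slack (M ／ {e}) (p - 1) q := by
      rw [h]; linarith
    linarith

/-- From the averaged (MC), SOME element satisfies (MC): `(MC-avg) ⟹ (MC∃)` — the hypothesis of C-037 at `(M, p, q)`. -/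
theorem exists_slack_contract_le_of_avg {p q : ℕ} (hE : M.E.ncard = p + q) (hq : 1 ≤ q)
    (havg : ∑ e ∈ (M.set_finite M.E).toFinset, Matroid.slack (M ／ {e}) (p - 1) q ≤
        (M.E.ncard : ℚ) * Matroid.slack M p q) :
    ∃ e ∈ M.E, Matroid.slack (M ／ {e}) (p - 1) q ≤ Matroid.slack M p q := by
  by_contra hcon
  simp only [not_exists, not_and, not_le] at hcon
  have hne : (M.set_finite M.E).toFinset.Nonempty := by
    rw [Set.Finite.toFinset_nonempty]
    rw [← Set.ncard_pos (M.set_finite M.E), hE]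
    omega
  have hcard : ((M.set_finite M.E).toFinset.card : ℚ) = (M.E.ncard : ℚ) := by
    rw [Set.ncard_eq_toFinset_card _ (M.set_finite M.E)]
  have hlt : (M.E.ncard : ℚ) * Matroid.slack M p q <
      ∑ e ∈ (M.set_finite M.E).toFinset, Matroid.slack (M ／ {e}) (p - 1) q := by
    rw [← hcard]
    have : ∑ _e ∈ (M.set_finite M.E).toFinset, Matroid.slack M p q <
        ∑ e ∈ (M.set_finite M.E).toFinset, Matroid.slack (M ／ {e}) (p - 1) q :=
      Finset.sum_lt_sum_of_nonempty hne (fun e he => hcon e ((Set.Finite.mem_toFinset _).1 he))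
    simpa [Finset.sum_const, nsmul_eq_mul] using this
  linarith

end PercRepro
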